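import Summits.AtomisticToContinuum.Crystallization.Theorems.FrustratedLawDichotomyStrainedPatchGaugeCellsA

/-!
# «GaugeCells» (lens-5 g63, 27623 T-side) — part B (sequel of `…FrustratedLawDichotomyStrainedPatchGaugeCellsA`)

Split for the 400-line cap by the landing lane (hand-2 g29); the module docstring of part A describes the whole node.  Same namespace; all FQNs unchanged.
0 sorry; standard axioms.
-/

noncomputable section

namespace Summit.AtomisticToContinuum.Crystallization.Theorems.FrustratedLawDichotomyStrainedPatchGaugeCells
open scoped BigOperators Classical RealInnerProductSpace
open Summit.AtomisticToContinuum.Crystallization.Theorems.FrustratedLawDichotomyPeriodicBlockFlags (goodAtScale_mono)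
open Summit.AtomisticToContinuum.Crystallization.Theorems.FrustratedLawDichotomyRangeCut (Sep)
open Summit.AtomisticToContinuum.Crystallization.Theorems.FrustratedLawDichotomyMotifLemmas
open Summit.AtomisticToContinuum.Crystallization.Theorems.FrustratedLawDichotomyAveragingCut
open Summit.AtomisticToContinuum.Crystallization.Theorems.FrustratedLawDichotomyAveragingRuleCap
open Summit.AtomisticToContinuum.Crystallization.Theorems.FrustratedLawDichotomyAveragingRuleTightFree
open Summit.AtomisticToContinuum.Crystallization.Theorems.FrustratedLawDichotomyExemptDoor (SitePred)
open Summit.AtomisticToContinuum.Crystallization.Theorems.FrustratedLawDichotomyExemptAbsorption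
open Summit.AtomisticToContinuum.Crystallization.Theorems.FrustratedLawDichotomyExemptAbsorptionRecord
open Summit.AtomisticToContinuum.Crystallization.Theorems.FrustratedLawDichotomyCollarCensus
open Summit.AtomisticToContinuum.Crystallization.Theorems.FrustratedLawDichotomyCollarCensusKappa
open Summit.AtomisticToContinuum.Crystallization.Theorems.FrustratedLawDichotomyStrainedPatchHomSplit
open Summit.AtomisticToContinuum.Crystallization.Theorems.FrustratedLawDichotomyStrainedPatchCleanCollar
open Summit.AtomisticToContinuum.Crystallization.Theorems.FrustratedLawDichotomyStrainedPatchHomTube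
open Summit.AtomisticToContinuum.Crystallization.Theorems.FrustratedLawDichotomyStrainedPatchHomPolar
open Summit.AtomisticToContinuum.Crystallization.Theorems.FrustratedLawDichotomyStrainedPatchHomIsometry
open Summit.AtomisticToContinuum.Crystallization.Theorems.FrustratedLawDichotomyStrainedPatchHomTubeIso
open Summit.AtomisticToContinuum.Crystallization.Theorems.FrustratedLawDichotomyStrainedPatchPhaseCut
open Summit.AtomisticToContinuum.Crystallization.Theorems.FrustratedLawDichotomyStrainedPatchCoreTube
open Summit.AtomisticToContinuum.Crystallization.Theorems.FrustratedLawDichotomyStrainedPatchCoreTubeRecord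
open Summit.AtomisticToContinuum.Crystallization.Theorems.FrustratedLawDichotomyStrainedPatchCoreTubeMilli
open Summit.AtomisticToContinuum.Crystallization.Theorems.FrustratedLawDichotomyStrainedPatchStrainBands
open Summit.AtomisticToContinuum.Crystallization.Theorems.FrustratedLawDichotomyStrainedPatchChartFamilies
open Summit.AtomisticToContinuum.Crystallization.Theorems.FrustratedLawDichotomyStrainedPatchChartFamiliesBent
open Summit.AtomisticToContinuum.Crystallization.Theorems.FrustratedLawDichotomyStrainedPatchChartFamiliesPinned
open Summit.AtomisticToContinuum.Crystallization.Theorems.FrustratedLawDichotomyStrainedPatchRecutPairs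
open Summit.AtomisticToContinuum.Crystallization.Theorems.FrustratedLawDichotomyStrainedPatchRecutKinematics
open Summit.AtomisticToContinuum.Crystallization.Theorems.FrustratedLawDichotomyStrainedPatchWindowFamilies
open Summit.AtomisticToContinuum.Crystallization.Theorems.FrustratedLawDichotomyStrainedPatchHostCells

/-! ## §3. Cell status at ONE reference: dead (vacuous), sitewise (trivial), live — and the window transfer through the bond chart -/

/-- **`Charted z₁ c₁ τ κ lam M z c e'`** — the four hypotheses of one instance of (FT): an admissible, `63/10`-clean, `63/10`-mono-phase record cluster
bond-charted by the reference with tolerances `(2τ, κ, lam)`. -/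
def Charted {M₁ : ℕ} (z₁ : Fin M₁ → E3) (c₁ : Fin M₁) (τ κ lam : ℝ) (M : ℕ) (z : Fin M → E3) (c : Fin M) (e' : Fin M → Fin M₁) : Prop :=
  Admissible M z c ∧ CleanBall (63 / 10) z c ∧ MonoPhaseBall (63 / 10) z c ∧ BondChart τ κ lam z c z₁ c₁ e'

/-- **`DeadRef z₁ c₁ τ κ lam` [DEAD CELL]** — NO record cluster is charted by the reference: (FT) holds VACUOUSLY. -/
def DeadRef {M₁ : ℕ} (z₁ : Fin M₁ → E3) (c₁ : Fin M₁) (τ κ lam : ℝ) : Prop :=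
  ∀ (M : ℕ) (z : Fin M → E3) (c : Fin M) (e' : Fin M → Fin M₁), ¬Charted z₁ c₁ τ κ lam M z c e'

/-- **`SitewiseRef z₁ c₁ τ κ lam` [SITEWISE CELL]** — every charted cluster has ALL member surpluses `x_j ≥ 0` on its `9/5`-ball: (FT) holds TRIVIALLY. -/
def SitewiseRef {M₁ : ℕ} (z₁ : Fin M₁ → E3) (c₁ : Fin M₁) (τ κ lam : ℝ) : Prop :=
  ∀ (M : ℕ) (z : Fin M → E3) (c : Fin M) (e' : Fin M → Fin M₁), Charted z₁ c₁ τ κ lam M z c e' → ∀ j ∈ ball (9 / 5) z c, 0 ≤ xRec M z j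

/-- (FT) restated through `Charted`. [formal bookkeeping] -/
theorem fatTubeFloor_iff_charted {M₁ : ℕ} (z₁ : Fin M₁ → E3) (c₁ : Fin M₁) (τ κ lam : ℝ) :
    FatTubeFloor z₁ c₁ τ κ lam ↔ ∀ (M : ℕ) (z : Fin M → E3) (c : Fin M) (e' : Fin M → Fin M₁), Charted z₁ c₁ τ κ lam M z c e' → 0 ≤ ballAvg (9 / 5) z (xRec M z) c :=
  ⟨fun h M z c e' hch => h M z c e' hch.1 hch.2.1 hch.2.2.1 hch.2.2.2, fun h M z c e' hz hcl hm hb => h M z c e' ⟨hz, hcl, hm, hb⟩⟩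

/-- ★ A DEAD reference is certified (vacuously). [formal bookkeeping] -/
theorem fatTubeFloor_of_deadRef {M₁ : ℕ} {z₁ : Fin M₁ → E3} {c₁ : Fin M₁} {τ κ lam : ℝ} (h : DeadRef z₁ c₁ τ κ lam) : FatTubeFloor z₁ c₁ τ κ lam :=
  fun M z c e' hz hcl hm hb => (h M z c e' ⟨hz, hcl, hm, hb⟩).elim

/-- A ball average of sitewise nonnegative scores is nonnegative. [folklore] -/
theorem ballAvg_nonneg_of_sitewise {N : ℕ} {y : Fin N → E3} {x : Fin N → ℝ} {i : Fin N} {ρ : ℝ} (h : ∀ j ∈ ball ρ y i, 0 ≤ x j) : 0 ≤ ballAvg ρ y x i :=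
  Finset.sum_nonneg fun j hj => div_nonneg (h j hj) (Nat.cast_nonneg _)

/-- ★ A SITEWISE reference is certified (trivially). [formal bookkeeping] -/
theorem fatTubeFloor_of_sitewiseRef {M₁ : ℕ} {z₁ : Fin M₁ → E3} {c₁ : Fin M₁} {τ κ lam : ℝ} (h : SitewiseRef z₁ c₁ τ κ lam) : FatTubeFloor z₁ c₁ τ κ lam :=
  fun M z c e' hz hcl hm hb => ballAvg_nonneg_of_sitewise (h M z c e' ⟨hz, hcl, hm, hb⟩)

/-- ★★ **CELL STATUS JUNCTION**: dead ∨ sitewise ∨ certified ⟹ certified — only the LIVE cells (neither dead nor sitewise) cost a fat-tube certificate. [folklore] -/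
theorem fatTubeFloor_of_status {M₁ : ℕ} {z₁ : Fin M₁ → E3} {c₁ : Fin M₁} {τ κ lam : ℝ}
    (h : DeadRef z₁ c₁ τ κ lam ∨ SitewiseRef z₁ c₁ τ κ lam ∨ FatTubeFloor z₁ c₁ τ κ lam) : FatTubeFloor z₁ c₁ τ κ lam := by
  rcases h with h | h | h
  exacts [fatTubeFloor_of_deadRef h, fatTubeFloor_of_sitewiseRef h, h]

/-- … for 61H's finite nets: a status for every reference ⟹ `NetCert`. [formal bookkeeping] -/
theorem netCert_of_status {K : ℕ} {N : RefNet K} {τ κ lam : ℝ}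
    (h : ∀ k, DeadRef (N.z k) (N.c k) τ κ lam ∨ SitewiseRef (N.z k) (N.c k) τ κ lam ∨ FatTubeFloor (N.z k) (N.c k) τ κ lam) : NetCert N τ κ lam :=
  fun k => fatTubeFloor_of_status (h k)

/-- … for any indexed family of references (62B's `ExactCert` ranges over `(k, G, ξ, b)`): pointwise status ⟹ pointwise certificate. [formal bookkeeping] -/
theorem forall_fatTubeFloor_of_status {ι : Sort*} {M₁ : ι → ℕ} {z₁ : (i : ι) → Fin (M₁ i) → E3} {c₁ : (i : ι) → Fin (M₁ i)} {τ κ lam : ℝ}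
    (h : ∀ i, DeadRef (z₁ i) (c₁ i) τ κ lam ∨ SitewiseRef (z₁ i) (c₁ i) τ κ lam ∨ FatTubeFloor (z₁ i) (c₁ i) τ κ lam) : ∀ i, FatTubeFloor (z₁ i) (c₁ i) τ κ lam :=
  fun i => fatTubeFloor_of_status (h i)

/-- Dead and sitewise status are ANTITONE in the tolerances (a certificate at `(τ', κ', lam')` serves every smaller tolerance). [formal bookkeeping] -/
theorem Charted.mono {M₁ : ℕ} {z₁ : Fin M₁ → E3} {c₁ : Fin M₁} {τ τ' κ κ' lam lam' : ℝ} {M : ℕ} {z : Fin M → E3} {c : Fin M} {e' : Fin M → Fin M₁}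
    (h : Charted z₁ c₁ τ κ lam M z c e') (hτ : τ ≤ τ') (hκ : κ ≤ κ') (hl : lam ≤ lam') : Charted z₁ c₁ τ' κ' lam' M z c e' := by
  refine ⟨h.1, h.2.1, h.2.2.1, h.2.2.2.1, fun a b ha hb => (h.2.2.2.2.1 a b ha hb).trans ?_, h.2.2.2.2.2⟩
  have h₁ : 0 ≤ dist (z₁ (e' a)) (z₁ (e' b)) := dist_nonneg
  have h₂ : 0 ≤ dist (z₁ (e' a)) (z₁ c₁) ^ 2 + dist (z₁ (e' b)) (z₁ c₁) ^ 2 := by positivity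
  nlinarith [mul_le_mul_of_nonneg_right hκ h₁, mul_le_mul_of_nonneg_right hl h₂]

/-- `DeadRef.anti` (docstring: see `Charted.mono`). [formal bookkeeping] -/
theorem DeadRef.anti {M₁ : ℕ} {z₁ : Fin M₁ → E3} {c₁ : Fin M₁} {τ τ' κ κ' lam lam' : ℝ} (h : DeadRef z₁ c₁ τ' κ' lam') (hτ : τ ≤ τ') (hκ : κ ≤ κ')
    (hl : lam ≤ lam') : DeadRef z₁ c₁ τ κ lam :=
  fun M z c e' hch => h M z c e' (hch.mono hτ hκ hl)

/-- `SitewiseRef.anti` (docstring: see `Charted.mono`). [formal bookkeeping] -/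
theorem SitewiseRef.anti {M₁ : ℕ} {z₁ : Fin M₁ → E3} {c₁ : Fin M₁} {τ τ' κ κ' lam lam' : ℝ} (h : SitewiseRef z₁ c₁ τ' κ' lam') (hτ : τ ≤ τ') (hκ : κ ≤ κ')
    (hl : lam ≤ lam') : SitewiseRef z₁ c₁ τ κ lam :=
  fun M z c e' hch => h M z c e' (hch.mono hτ hκ hl)

/-! ### The window transfer (cluster side, PROVED) -/

/-- ★ **(T1) CLEAN TRANSFER**: under a chart of a `63/10`-clean cluster, every reference site within `6` of `c₁` is the label of a `1/8`-GOOD cluster site within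
`63/10` of the centre (covering clause ∧ `CleanBall`). [folklore] -/
theorem charted_ref_site_good {M₁ : ℕ} {z₁ : Fin M₁ → E3} {c₁ : Fin M₁} {τ κ lam : ℝ} {M : ℕ} {z : Fin M → E3} {c : Fin M} {e' : Fin M → Fin M₁}
    (h : Charted z₁ c₁ τ κ lam M z c e') {a₁ : Fin M₁} (ha₁ : dist (z₁ a₁) (z₁ c₁) ≤ 6) :
    ∃ a, dist (z a) (z c) ≤ 63 / 10 ∧ e' a = a₁ ∧ GoodAtScale (1 / 8) (3 / 2) z a := by
  obtain ⟨-, hcl, -, hch⟩ := h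
  obtain ⟨a, ha, hea⟩ := hch.2.2.2 a₁ ha₁
  exact ⟨a, ha, hea, hcl a ha⟩

/-- ★ **(T2) WINDOW-LO / FORCE-CAP TRANSFER**: admissibility (`¬ExemptNear (9/5) ExRec z c`, read at the member `j = c`) forbids, within `9/2` of the centre,
every `1/20`-good site and every non-equilibrium-core witness at scales `s ∈ [0, 3/2]`. [folklore] -/
theorem admissible_window_lo {M : ℕ} {z : Fin M → E3} {c : Fin M} (hz : Admissible M z c) {a : Fin M} (ha : dist (z a) (z c) ≤ 9 / 2) :
    ¬GoodAtScale (1 / 20) (3 / 2) z a ∧ ∀ s : ℝ, 0 ≤ s → s ≤ 3 / 2 → ¬NonEquilibriumCore (-(7175 / 10000)) 0 7 s (1 / 10000) M z a := by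
  have hne : ¬ExemptNear (9 / 5) ExRec z c := hz.2.2.2.2.1
  have key : ((∃ s : ℝ, 0 ≤ s ∧ s ≤ 3 / 2 ∧ NonEquilibriumCore (-(7175 / 10000)) 0 7 s (1 / 10000) M z a) ∨ GoodAtScale (1 / 20) (3 / 2) z a) → False := by
    intro hP
    apply hne
    have hc : c ∈ ball (9 / 5) z c := mem_ball.2 (by rw [dist_self]; norm_num)
    exact ⟨c, hc, a, mem_ball.2 ha, hP⟩
  exact ⟨fun hg => key (Or.inr hg), fun s hs hs' hN => key (Or.inl ⟨s, hs, hs', hN⟩)⟩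

/-- ★ **(T3) CENTRE-DISTANCE TRANSFER**: the cluster preimage `a` of the reference site `a₁` lies within `d₁ + 2τ + κ d₁ + lam d₁²` of the centre, `d₁ = dist (z₁ a₁) (z₁ c₁)`.
[folklore] -/
theorem charted_dist_centre_le {M₁ : ℕ} {z₁ : Fin M₁ → E3} {c₁ : Fin M₁} {τ κ lam : ℝ} {M : ℕ} {z : Fin M → E3} {c : Fin M} {e' : Fin M → Fin M₁}
    (h : Charted z₁ c₁ τ κ lam M z c e') {a : Fin M} (ha : dist (z a) (z c) ≤ 63 / 10) :
    dist (z a) (z c) ≤ dist (z₁ (e' a)) (z₁ c₁) + (2 * τ + κ * dist (z₁ (e' a)) (z₁ c₁) + lam * dist (z₁ (e' a)) (z₁ c₁) ^ 2) := by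
  obtain ⟨-, -, -, hec, hdev, -, -⟩ := h
  have hc : dist (z c) (z c) ≤ 63 / 10 := by rw [dist_self]; norm_num
  have h₁ := hdev a c ha hc
  rw [hec, dist_self] at h₁
  have h₂ : (0 : ℝ) ^ 2 = 0 := by norm_num
  rw [h₂, add_zero] at h₁
  have h₃ := (abs_sub_le_iff.1 h₁).1
  linarith

/-! ### The census's one-site infeasibility certificates, typed, and their junctions to DEAD -/

/-- **`LooseWitness z₁ c₁ τ κ lam a₁` [DEAD-hi certificate at the reference site `a₁` · INSTRUMENTABLE]** — every cluster site charted onto `a₁` is NOT `1/8`-good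
(census: the `2τ`-robust shell data of `a₁` in the reference violate a necessary distance condition of `1/8`-goodness; memo §3). -/
def LooseWitness {M₁ : ℕ} (z₁ : Fin M₁ → E3) (c₁ : Fin M₁) (τ κ lam : ℝ) (a₁ : Fin M₁) : Prop :=
  ∀ (M : ℕ) (z : Fin M → E3) (c : Fin M) (e' : Fin M → Fin M₁), Charted z₁ c₁ τ κ lam M z c e' →
    ∀ a, dist (z a) (z c) ≤ 63 / 10 → e' a = a₁ → ¬GoodAtScale (1 / 8) (3 / 2) z a

/-- **`TightWitness z₁ c₁ τ κ lam a₁` [DEAD-lo certificate · INSTRUMENTABLE ← shell rigidity]** — every cluster site charted onto `a₁` IS `1/20`-good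
(census: the reference shell of `a₁` is `1/20`-good with margin `> 2τ`-worth; memo §3). -/
def TightWitness {M₁ : ℕ} (z₁ : Fin M₁ → E3) (c₁ : Fin M₁) (τ κ lam : ℝ) (a₁ : Fin M₁) : Prop :=
  ∀ (M : ℕ) (z : Fin M → E3) (c : Fin M) (e' : Fin M → Fin M₁), Charted z₁ c₁ τ κ lam M z c e' →
    ∀ a, dist (z a) (z c) ≤ 63 / 10 → e' a = a₁ → GoodAtScale (1 / 20) (3 / 2) z a

/-- **`CoreWitness z₁ c₁ τ κ lam a₁` [DEAD-core certificate · INSTRUMENTABLE ← force cap]** — every cluster site charted onto `a₁` carries a non-equilibrium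
core witness of record at some scale `s ∈ [0, 3/2]`. -/
def CoreWitness {M₁ : ℕ} (z₁ : Fin M₁ → E3) (c₁ : Fin M₁) (τ κ lam : ℝ) (a₁ : Fin M₁) : Prop :=
  ∀ (M : ℕ) (z : Fin M → E3) (c : Fin M) (e' : Fin M → Fin M₁), Charted z₁ c₁ τ κ lam M z c e' →
    ∀ a, dist (z a) (z c) ≤ 63 / 10 → e' a = a₁ → ∃ s : ℝ, 0 ≤ s ∧ s ≤ 3 / 2 ∧ NonEquilibriumCore (-(7175 / 10000)) 0 7 s (1 / 10000) M z a

/-- ★ **DEAD-hi**: a loose witness at a reference site within `6` of the centre kills the cell (T1). [folklore] -/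
theorem deadRef_of_looseWitness {M₁ : ℕ} {z₁ : Fin M₁ → E3} {c₁ : Fin M₁} {τ κ lam : ℝ} {a₁ : Fin M₁} (ha₁ : dist (z₁ a₁) (z₁ c₁) ≤ 6)
    (hW : LooseWitness z₁ c₁ τ κ lam a₁) : DeadRef z₁ c₁ τ κ lam := by
  intro M z c e' hch
  obtain ⟨a, ha, hea, hg⟩ := charted_ref_site_good hch ha₁
  exact hW M z c e' hch a ha hea hg

/-- ★ **DEAD-lo**: a tight witness at a reference site whose fat distance to the centre is `≤ 9/2` kills the cell (T1 ∧ T3 ∧ T2). [folklore] -/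
theorem deadRef_of_tightWitness {M₁ : ℕ} {z₁ : Fin M₁ → E3} {c₁ : Fin M₁} {τ κ lam : ℝ} {a₁ : Fin M₁} (ha₁ : dist (z₁ a₁) (z₁ c₁) ≤ 6)
    (hroom : dist (z₁ a₁) (z₁ c₁) + (2 * τ + κ * dist (z₁ a₁) (z₁ c₁) + lam * dist (z₁ a₁) (z₁ c₁) ^ 2) ≤ 9 / 2)
    (hW : TightWitness z₁ c₁ τ κ lam a₁) : DeadRef z₁ c₁ τ κ lam := by
  intro M z c e' hch
  obtain ⟨a, ha, hea, -⟩ := charted_ref_site_good hch ha₁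
  have hd := charted_dist_centre_le hch ha
  rw [hea] at hd
  exact (admissible_window_lo hch.1 (hd.trans hroom)).1 (hW M z c e' hch a ha hea)

/-- ★ **DEAD-core**: a core witness at a reference site whose fat distance to the centre is `≤ 9/2` kills the cell (T1 ∧ T3 ∧ T2). [folklore] -/
theorem deadRef_of_coreWitness {M₁ : ℕ} {z₁ : Fin M₁ → E3} {c₁ : Fin M₁} {τ κ lam : ℝ} {a₁ : Fin M₁} (ha₁ : dist (z₁ a₁) (z₁ c₁) ≤ 6)
    (hroom : dist (z₁ a₁) (z₁ c₁) + (2 * τ + κ * dist (z₁ a₁) (z₁ c₁) + lam * dist (z₁ a₁) (z₁ c₁) ^ 2) ≤ 9 / 2)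
    (hW : CoreWitness z₁ c₁ τ κ lam a₁) : DeadRef z₁ c₁ τ κ lam := by
  intro M z c e' hch
  obtain ⟨a, ha, hea, -⟩ := charted_ref_site_good hch ha₁
  have hd := charted_dist_centre_le hch ha
  rw [hea] at hd
  obtain ⟨s, hs, hs', hN⟩ := hW M z c e' hch a ha hea
  exact (admissible_window_lo hch.1 (hd.trans hroom)).2 s hs hs' hN

/-- The witnesses are ANTITONE in the tolerances, like the dead status they produce. [formal bookkeeping] -/
theorem TightWitness.anti {M₁ : ℕ} {z₁ : Fin M₁ → E3} {c₁ : Fin M₁} {τ τ' κ κ' lam lam' : ℝ} {a₁ : Fin M₁} (h : TightWitness z₁ c₁ τ' κ' lam' a₁) (hτ : τ ≤ τ')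
    (hκ : κ ≤ κ') (hl : lam ≤ lam') : TightWitness z₁ c₁ τ κ lam a₁ :=
  fun M z c e' hch => h M z c e' (hch.mono hτ hκ hl)

/-- `LooseWitness.anti` (docstring: see `TightWitness.anti`). [formal bookkeeping] -/
theorem LooseWitness.anti {M₁ : ℕ} {z₁ : Fin M₁ → E3} {c₁ : Fin M₁} {τ τ' κ κ' lam lam' : ℝ} {a₁ : Fin M₁} (h : LooseWitness z₁ c₁ τ' κ' lam' a₁) (hτ : τ ≤ τ')
    (hκ : κ ≤ κ') (hl : lam ≤ lam') : LooseWitness z₁ c₁ τ κ lam a₁ :=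
  fun M z c e' hch => h M z c e' (hch.mono hτ hκ hl)

/-- At the record tolerances `(1/80, 0, 0)` the room condition reads `dist (z₁ a₁) (z₁ c₁) ≤ 179/40`. [formal bookkeeping] -/
theorem room_record {d : ℝ} (hd : d ≤ 179 / 40) : d + (2 * (1 / 80 : ℝ) + 0 * d + 0 * d ^ 2) ≤ 9 / 2 := by
  nlinarith

end Summit.AtomisticToContinuum.Crystallization.Theorems.FrustratedLawDichotomyStrainedPatchGaugeCells

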